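import Summits.BirchSwinnertonDyer.BirchSwinnertonDyer.Theorems.SignedLowerHalvesKobayashiLowerHalfLargeImageBSTWTwistScopedShape
import Summits.BirchSwinnertonDyer.Rank1Residual.Supersingular.KobayashiMainConjectureX7BSTWScopeDef
import HarnessLib

/-!
# Route `SignedLowerHalves`, crux `KobayashiLowerHalfLargeImage` (item stmt-BirchSwinnertonDyer-19001): the BSTW-TWIST
# SUB-FAMILY of class X7 ON THE (def)-VARIANT TWIST SCOPE `S_tw^def` — PER-PAIR RECORD SHAPE and CLASS-WIDE CONSUMERS
# (cell `pub/bsd-litref`, paper sub-dir `bstw24`, prover seat `bsd-litref-bstw24-pv` gen 6; companion of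
# `…BSTWTwistScopedShape.lean` (p501067, the STRICT scope) and of the typer's `Supersingular/KobayashiMainConjectureX7BSTWScopeDef.lean`
# (p502031); a `--supports … --as helper` file; THEOREMS ONLY; closes nothing)

HONEST FRAMING (programme BSD-LIT2PART v1 §HONESTY, verbatim): «no tranche here proves BSD; ARM L moves the LITERAL column of
an r ≤ 1 census into the kernel-proved-modulo-named-print column; ARM P changes what "named print" is worth.»
Burungale–Skinner–Tian–Wan arXiv:2409.01350v2 is an UNREFEREED PREPRINT; its twist clause enters ONLY through explicitly labelled OPEN
binders taken as hypotheses — here the `S_tw^def`-SCOPED tiers `BurungaleSkinnerTianWan2024_cor102_twist_scopedSDef_OPEN` (`p ≥ 5`) /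
`…_scopedAtThreeSDef_OPEN` (`p = 3`) and `…_thm101_twist_scoped{SDef,AtThreeSDef}_OPEN` of `KobayashiMainConjectureX7BSTWScopeDef.lean`
(referee C4 ROUND C4-R3-ADD-6 (b): the (def)-variant «AUTHORISED OPTION only if typed to the print's (def) [L7390–7391] letter with pv's
candidates re-checked against it» — typed by the typer g8 p502031, candidates re-checked by this seat (21 pairs pass the letter, 4 fail)),
never as theorems. Records ≠ bookings ≠ crux closure; class X7 stays CONSTRUCTION-SHAPED; crux 3 stays OPEN; the desk words any tier;
typed ≠ proved ≠ endorsed.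

THE (def) SCOPE (Thm. 10.5 l.7389–7391 with `L := K`, §10.3 l.7457–7459): `K = ℚ(√d)` imaginary with `p` split, `d` odd and prime to
the bad primes, `2` split if good, every bad prime of `E₀` SPLIT or INERT-with-(ram), and the inert bad primes ODD in number —
`BSTWScope.IsAuxiliaryTwistDef W₀ p d` (typer). Per pair this is DECIDABLE data (`BSTWScope.isAuxiliaryTwistDef_of_kronecker`, with a
LIST `Q` of inert (ram) primes of odd length); census footprint: 21 pairs beyond the 5 strict ones (seat file
`staging/bsd-litref-bstw24-pv/X7-BSTWTWIST-RECORDS.md` § (def)).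

## What this file proves (namespace `Summit.BirchSwinnertonDyer.BirchSwinnertonDyer.Theorems.X7Twist`)

* `exists_twistAuxDef_of_certs` — the (def)-SCOPED TWIST DATUM of a pair, UNCONDITIONAL and binder-free: the BODY datum of
  `exists_twistBody_of_certs` ∧ `BSTWScope.IsAuxiliaryTwistDef W₀ p d`, from the body certificates plus: the factorisation list of `|Δ₀|`,
  a list `Q` of (prime, valuation) pairs — the inert bad primes, each certified (ram) (`q ∣ Δ₀`, `q ∤ c₄`, `q^v ∥ Δ₀`, `p ∤ v`) and
  inert (`(d/q) = −1`, resp. `d ≡ 5 (mod 8)` at `q = 2`), `Q` without duplicates and of ODD length —, `(d/p) = +1`, no bad prime divides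
  `d`, every bad prime outside `Q` split.
* `bsdp_of_cor102_twist_scopedSDef_OPEN_of_twistAuxDef` / `…AtThreeSDef…` — `BSDp W p` from a (def)-scoped datum, CONDITIONAL on the
  (def)-scoped p-part tier (+ GZK + analytic rank `≤ 1`), via the typer's `bsdp_of_cor102_twist_scoped{SDef,AtThreeSDef}_OPEN`.
* `exists_kobayashiLowerDivisibility_of_thm101_twist_scoped{SDef,AtThreeSDef}_OPEN_of_twistAuxDef` — the crux's conclusion
  `∃ ε, KobayashiLowerDivisibility W p ε` at a (def)-scoped twist, CONDITIONAL on the MC-level (def)-scoped tier.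

Design: THEOREMS ONLY; default heartbeats; axioms standard. References: [BurungaleSkinnerTianWan2024] Cor. 10.2 (p. 86), Thm. 10.5 (def)
l.7389–7391, §10.3; [Cox2013] §7.B Thm. 7.7(ii); [Marcus2018] Ch. 3 Thm. 25; [SilvermanAEC2009] VII.5 Prop. 5.1; [SkinnerUrban2014] Thm. 2 ((ram));
[Miller2011LMS] Def. 1.1.
-/

set_option autoImplicit false
set_option linter.dupNamespace false

noncomputable section

open scoped Classical

open WeierstrassCurve Literature.NumberTheory.EllipticCurves
  Literature.NumberTheory.EllipticCurves.Rank1Residual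
  Literature.NumberTheory.EllipticCurves.Rank1Residual.X11RankOneCertificates
  Literature.NumberTheory.EllipticCurves.BurungaleSkinnerTianWan2024
  Summit.BirchSwinnertonDyer.BirchSwinnertonDyer.Rank1Residual.IntModel
  Summit.BirchSwinnertonDyer.BirchSwinnertonDyer.Rank1Residual.X11RankOne
  Summit.BirchSwinnertonDyer.Rank1Residual.X11b
  Summit.BirchSwinnertonDyer.Rank1Residual.Supersingular
  Summit.BirchSwinnertonDyer.Rank1Residual.SecondDescent

namespace Summit.BirchSwinnertonDyer.BirchSwinnertonDyer.Theorems.X7Twist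

/-! ### §1 The (def)-scoped twist datum of a pair -/

section ScopedDefDatum

variable (p : ℕ) [Fact p.Prime]
  (a1 a2 a3 a4 a6 b1 b2 b3 b4 b6 : ℤ)
  [hEb : (⟨b1, b2, b3, b4, b6⟩ : WeierstrassCurve ℚ).IsElliptic]
  [hMb : (⟨b1, b2, b3, b4, b6⟩ : WeierstrassCurve ℚ).IsGloballyMinimal]

/-- **The (def)-SCOPED twist datum of a pair from certificates.** As `exists_twistAux_of_certs` but with a LIST `Q` of (inert bad prime,
valuation) pairs in place of the single (ram) prime: every `(q, v) ∈ Q` has `q` prime, `≠ p`, `q ∣ Δ₀`, `q ∤ c₄(E₀)`, `q^v ∥ Δ₀`, `p ∤ v`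
((ram)) and `q` inert in `ℚ(√d)` (`(d/q) = −1`, resp. `d ≡ 5 (mod 8)` at `q = 2`); the primes of `Q` are pairwise distinct and ODD in
number; every listed bad prime outside `Q` splits. Conclusion: the BODY datum ∧ `BSTWScope.IsAuxiliaryTwistDef W₀ p d`
(`BSTWScope.isAuxiliaryTwistDef_of_kronecker`). UNCONDITIONAL; per pair; nothing booked. [cite: Cox2013, §7.B Thm. 7.7(ii)]
[cite: Marcus2018, Ch. 3 Thm. 25 (decomposition law at 2)] [cite: SilvermanAEC2009, III.1 Table 3.1, VII.5 Prop. 5.1]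
[cite: SkinnerUrban2014, Thm. 2 (p. 3), second bullet (shape of (ram) only)] -/
theorem exists_twistAuxDef_of_certs (hp2 : p ≠ 2) (d : ℤ) (u r s t : ℚ) (hu : u ≠ 0)
    (h1 : (a1 : ℚ) + 2 * s = 0)
    (h2' : (a2 : ℚ) - s * a1 + 3 * r - s ^ 2 = u ^ 2 * ((d : ℚ) * ((b1 : ℚ) ^ 2 + 4 * b2) / 4))
    (h3 : (a3 : ℚ) + r * a1 + 2 * t = 0)
    (h4 : (a4 : ℚ) - s * a3 + 2 * r * a2 - (t + r * s) * a1 + 3 * r ^ 2 - 2 * s * t =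
      u ^ 4 * ((d : ℚ) ^ 2 * (2 * (b4 : ℚ) + b1 * b3) / 2))
    (h6 : (a6 : ℚ) + r * a4 + r ^ 2 * a2 + r ^ 3 - t * a3 - t ^ 2 - r * t * a1 =
      u ^ 6 * ((d : ℚ) ^ 3 * ((b3 : ℚ) ^ 2 + 4 * b6) / 4))
    (hgcd : Int.gcd (discOf [b1, b2, b3, b4, b6]) (c4Of [b1, b2, b3, b4, b6]) = 1)
    (hpΔ : ¬ (p : ℤ) ∣ discOf [b1, b2, b3, b4, b6]) (hcnt : countPoints [b1, b2, b3, b4, b6] p = (p + 1 : ℕ))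
    (hd : ∀ q < d.natAbs + 1, 2 ≤ q → ¬ q * q ∣ d.natAbs) (hd0 : d ≠ 0) (hd1 : d ≠ 1) (L : List ℕ)
    (hLcov : ∀ q < d.natAbs + 1, q.Prime → q ∣ d.natAbs → q = 2 ∨ q ∈ L)
    (hL : ∀ q ∈ L, q.Prime ∧ q ≠ p ∧ ¬ (q : ℤ) ∣ discOf [b1, b2, b3, b4, b6])
    (h2 : d % 4 ≠ 1 → ¬ (2 : ℤ) ∣ discOf [b1, b2, b3, b4, b6])
    -- the (def) scope data
    (F : List (ℕ × ℕ)) (hF : (discOf [b1, b2, b3, b4, b6]).natAbs = (F.map fun qe => qe.1 ^ qe.2).prod)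
    (hpr : ∀ qe ∈ F, qe.1.Prime) (Q : List (ℕ × ℕ)) (hQnd : (Q.map Prod.fst).Nodup) (hQodd : Odd Q.length)
    (hQcert : ∀ qv ∈ Q, qv.1.Prime ∧ qv.1 ≠ p ∧ (qv.1 : ℤ) ∣ discOf [b1, b2, b3, b4, b6] ∧
      ¬ (qv.1 : ℤ) ∣ c4Of [b1, b2, b3, b4, b6] ∧ (qv.1 : ℤ) ^ qv.2 ∣ discOf [b1, b2, b3, b4, b6] ∧
      ¬ (qv.1 : ℤ) ^ (qv.2 + 1) ∣ discOf [b1, b2, b3, b4, b6] ∧ ¬ p ∣ qv.2)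
    (hQkron : ∀ qv ∈ Q, (qv.1 = 2 → d % 8 = 5) ∧ (qv.1 ≠ 2 → jacobiSym d qv.1 = -1))
    (hdneg : d < 0) (hd4 : d % 4 = 1) (hsp : jacobiSym d p = 1)
    (hFd : ∀ qe ∈ F, ¬ (qe.1 : ℤ) ∣ d)
    (hFsplit : ∀ qe ∈ F, qe.1 ∉ Q.map Prod.fst → (qe.1 = 2 → d % 8 = 1) ∧ (qe.1 ≠ 2 → jacobiSym d qe.1 = 1))
    (h2split : ¬ (2 : ℤ) ∣ discOf [b1, b2, b3, b4, b6] → d % 8 = 1) :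
    ∃ (W₀ : WeierstrassCurve ℚ) (_ : W₀.IsElliptic) (_ : W₀.IsGloballyMinimal) (d : ℤ) (C : VariableChange ℚ),
      Semistable W₀ ∧ GoodSS W₀ p ∧ W₀.frobeniusTrace p = 0 ∧ Squarefree d ∧ d ≠ 1 ∧
      (∀ (q : ℕ) [Fact q.Prime], RamifiedInQuadratic d q → q ≠ p ∧ W₀.HasGoodReductionAtPrime q) ∧
      C • (⟨a1, a2, a3, a4, a6⟩ : WeierstrassCurve ℚ) = W₀.quadraticTwist (d : ℚ) ∧
      BSTWScope.IsAuxiliaryTwistDef W₀ p d := by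
  have hIb := integralModelInt_lit b1 b2 b3 b4 b6
  have hmem := mem_of_not_hasGoodReductionAtPrime b1 b2 b3 b4 b6 F hF hpr
  have hsst := semistable_of_certs b1 b2 b3 b4 b6 hgcd
  have hss := goodSS_of_certs b1 b2 b3 b4 b6 p hp2 hpΔ hcnt
  have hap := frobeniusTrace_eq_zero_of_certs b1 b2 b3 b4 b6 p hp2 hpΔ hcnt
  have hdn : Squarefree d.natAbs := by
    intro x hx
    have hn0 : d.natAbs ≠ 0 := Int.natAbs_ne_zero.mpr hd0
    have hxle : x ≤ d.natAbs := Nat.le_of_dvd (Nat.pos_of_ne_zero hn0) (dvd_trans (dvd_mul_right x x) hx)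
    by_contra hx1
    rw [Nat.isUnit_iff] at hx1
    have hx0 : x ≠ 0 := by rintro rfl; exact hn0 (Nat.eq_zero_of_zero_dvd (by simpa using hx))
    exact hd x (Nat.lt_succ_of_le hxle) (by omega) hx
  have hd' : Squarefree d := Int.squarefree_natAbs.mp hdn
  have hgoodq : ∀ (q : ℕ) [Fact q.Prime], ¬ (q : ℤ) ∣ discOf [b1, b2, b3, b4, b6] →
      (⟨b1, b2, b3, b4, b6⟩ : WeierstrassCurve ℚ).HasGoodReductionAtPrime q := fun q _ hqΔ ↦
    hasGoodReductionAtPrime_of_not_dvd _ q (by rw [minimalDiscriminantInt_eq hIb, intCurve_Δ]; exact hqΔ)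
  have hram : ∀ (q : ℕ) [Fact q.Prime], RamifiedInQuadratic d q →
      q ≠ p ∧ (⟨b1, b2, b3, b4, b6⟩ : WeierstrassCurve ℚ).HasGoodReductionAtPrime q := by
    intro q hq h
    rcases ramifiedInQuadratic_cases hd' hq.out h with ⟨rfl, hd4'⟩ | ⟨hq2, hqd, hqlt⟩
    · exact ⟨Ne.symm hp2, hgoodq 2 (h2 hd4')⟩
    · have hm : q ∈ L := (hLcov q hqlt hq.out hqd).resolve_left hq2
      obtain ⟨-, hqp', hqΔ'⟩ := hL q hm
      exact ⟨hqp', hgoodq q hqΔ'⟩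
  have hC := smul_eq_quadraticTwist_of_eqs a1 a2 a3 a4 a6 b1 b2 b3 b4 b6 d u r s t hu h1 h2' h3 h4 h6
  -- the (def) scope: `d = -D`, the inert list `Q.map Prod.fst`
  obtain ⟨D, rfl⟩ : ∃ D : ℕ, d = -(D : ℤ) := ⟨d.natAbs, by omega⟩
  have htw : BSTWScope.IsAuxiliaryTwistDef (⟨b1, b2, b3, b4, b6⟩ : WeierstrassCurve ℚ) p (-(D : ℤ)) := by
    refine BSTWScope.isAuxiliaryTwistDef_of_kronecker _ p hp2 D ⟨hd4, hd', hd1⟩ hsp (Q.map Prod.fst) hQnd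
      (by simpa using hQodd) ?_ ?_ ?_ ?_
    · intro q hq
      obtain ⟨qv, hqv, rfl⟩ := List.mem_map.mp hq
      obtain ⟨hqP, hqp, hqΔ, hqc₄, hv, hv', hpv⟩ := hQcert qv hqv
      haveI : Fact qv.1.Prime := ⟨hqP⟩
      exact ⟨hqP, isAuxiliaryPrime_of_certs p b1 b2 b3 b4 b6 qv.1 qv.2 hqp hqΔ hqc₄ hv hv' hpv, hQkron qv hqv⟩
    · intro ℓ hℓ hbadℓ
      obtain ⟨qe, hqe, rfl⟩ := List.mem_map.mp (hmem ℓ hℓ hbadℓ)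
      have h := hFd qe hqe
      rwa [Int.dvd_neg] at h
    · intro ℓ hℓ hℓQ hbadℓ
      obtain ⟨qe, hqe, rfl⟩ := List.mem_map.mp (hmem ℓ hℓ hbadℓ)
      exact hFsplit qe hqe hℓQ
    · intro hgood2
      haveI : Fact (Nat.Prime 2) := ⟨Nat.prime_two⟩
      refine h2split ?_
      have h := WeierstrassCurve.not_dvd_minimalDiscriminantInt_of_hasGoodReductionAtPrime'
        (⟨b1, b2, b3, b4, b6⟩ : WeierstrassCurve ℚ) 2 hgood2
      rw [minimalDiscriminantInt_eq hIb, intCurve_Δ] at h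
      exact_mod_cast h
  exact ⟨_, hEb, hMb, _, _, hsst, hss, hap, hd', hd1, hram, hC, htw⟩

end ScopedDefDatum

/-! ### §2 Class-wide consumers of a (def)-scoped twist datum -/

section ScopedDefConsumers

variable (W : WeierstrassCurve ℚ) [W.IsElliptic] [W.IsGloballyMinimal] (p : ℕ) [Fact p.Prime]

/-- **`BSD(E, p)` from a (def)-SCOPED twist datum, CONDITIONAL on the `p ≥ 5` (def)-scoped tier of BSTW's twist clause (Cor. 10.2, road
B2, (def)-variant).** Binders: the PRE hypothesis `BurungaleSkinnerTianWan2024_cor102_twist_scopedSDef_OPEN` (UNREFEREED preprint restricted to the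
litref (def)-scope; never a theorem), GZK `hGZK` (PUBLISHED, by name), the pair's analytic rank `rk ≤ 1` (DATA). `Irr W p` from the
twist's own good supersingular reduction (`goodSS_of_twistBody`, Serre 1972 Prop. 12); ramified primes good ⟹ prime to `N₀`.
Via the typer's bridge `bsdp_of_cor102_twist_scopedS_OPEN`. Closes nothing; X7 stays CONSTRUCTION-SHAPED.
[claim: BurungaleSkinnerTianWan2024, status: under-review]
[cite: BurungaleSkinnerTianWan2024, Cor. 10.2, last sentence (p. 86) with §10.3 (l.7454–7479) (ANNOUNCED, OPEN binder, scoped)]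
[cite: Serre1972, §1.11 Prop. 12] [cite: Miller2011LMS, §1 and Def. 1.1] -/
theorem bsdp_of_cor102_twist_scopedSDef_OPEN_of_twistAuxDef
    (hBSTW : BurungaleSkinnerTianWan2024_cor102_twist_scopedSDef_OPEN)
    (hGZK : rank_eq_analyticRank_of_analyticRank_le_one) (hp5 : 5 ≤ p)
    (htw : ∃ (W₀ : WeierstrassCurve ℚ) (_ : W₀.IsElliptic) (_ : W₀.IsGloballyMinimal) (d : ℤ) (C : VariableChange ℚ),
      Semistable W₀ ∧ GoodSS W₀ p ∧ W₀.frobeniusTrace p = 0 ∧ Squarefree d ∧ d ≠ 1 ∧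
      (∀ (q : ℕ) [Fact q.Prime], RamifiedInQuadratic d q → q ≠ p ∧ W₀.HasGoodReductionAtPrime q) ∧
      C • W = W₀.quadraticTwist (d : ℚ) ∧ BSTWScope.IsAuxiliaryTwistDef W₀ p d)
    {rk : ℕ} (hr : W.analyticRank = rk) (hrk : rk ≤ 1) : BSDp W p := by
  have hp2 : p ≠ 2 := by omega
  obtain ⟨W₀, _, _, d, C, hsst, hss, hap, hd, hd1, hram, hC, haux⟩ := htw
  have hG := goodSS_of_twistBody W p hp2 ⟨W₀, ‹_›, ‹_›, d, C, hsst, hss, hap, hd, hd1, hram, hC⟩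
  have hram' : ∀ (q : ℕ) [Fact q.Prime], RamifiedInQuadratic d q → q ≠ p ∧ ¬ q ∣ W₀.conductorNorm ℤ := by
    intro q _ h
    obtain ⟨hqp, hgood⟩ := hram q h
    exact ⟨hqp, fun hdvd ↦ (W₀.dvd_conductorNorm_iff_not_hasGoodReductionAtPrime q).mp hdvd hgood⟩
  have hirr : Irr W p :=
    hasIrreducibleModPGaloisRep_of_dvd_frobeniusTrace W p hp2
      (W.not_dvd_minimalDiscriminantInt_of_hasGoodReductionAtPrime' p hG.1) hG.2
  exact bsdp_of_cor102_twist_scopedSDef_OPEN W₀ W p hBSTW hGZK hp5 hsst hss.1 hap hd hd1 hram' hC haux hirr (by omega)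

/-- **`BSD(E, 3)` from a (def)-SCOPED twist datum, CONDITIONAL on the `p = 3` (def)-scoped tier** (which rests at 3 on the wall of record,
[SV-S-Ohta], GAP(line) C4-R3 (β)): as `bsdp_of_cor102_twist_scopedSDef_OPEN_of_twistAuxDef` via `bsdp_of_cor102_twist_scopedAtThreeS_OPEN`.
Closes nothing. [claim: BurungaleSkinnerTianWan2024, status: under-review]
[cite: BurungaleSkinnerTianWan2024, Cor. 10.2, last sentence (p. 86) with §10.3 (ANNOUNCED, OPEN binder, scoped, p = 3)]
[cite: Serre1972, §1.11 Prop. 12] [cite: Miller2011LMS, §1 and Def. 1.1] -/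
theorem bsdp_of_cor102_twist_scopedAtThreeSDef_OPEN_of_twistAuxDef
    (hBSTW : BurungaleSkinnerTianWan2024_cor102_twist_scopedAtThreeSDef_OPEN)
    (hGZK : rank_eq_analyticRank_of_analyticRank_le_one) (hp3 : p = 3)
    (htw : ∃ (W₀ : WeierstrassCurve ℚ) (_ : W₀.IsElliptic) (_ : W₀.IsGloballyMinimal) (d : ℤ) (C : VariableChange ℚ),
      Semistable W₀ ∧ GoodSS W₀ p ∧ W₀.frobeniusTrace p = 0 ∧ Squarefree d ∧ d ≠ 1 ∧
      (∀ (q : ℕ) [Fact q.Prime], RamifiedInQuadratic d q → q ≠ p ∧ W₀.HasGoodReductionAtPrime q) ∧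
      C • W = W₀.quadraticTwist (d : ℚ) ∧ BSTWScope.IsAuxiliaryTwistDef W₀ p d)
    {rk : ℕ} (hr : W.analyticRank = rk) (hrk : rk ≤ 1) : BSDp W p := by
  have hp2 : p ≠ 2 := by omega
  obtain ⟨W₀, _, _, d, C, hsst, hss, hap, hd, hd1, hram, hC, haux⟩ := htw
  have hG := goodSS_of_twistBody W p hp2 ⟨W₀, ‹_›, ‹_›, d, C, hsst, hss, hap, hd, hd1, hram, hC⟩
  have hram' : ∀ (q : ℕ) [Fact q.Prime], RamifiedInQuadratic d q → q ≠ p ∧ ¬ q ∣ W₀.conductorNorm ℤ := by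
    intro q _ h
    obtain ⟨hqp, hgood⟩ := hram q h
    exact ⟨hqp, fun hdvd ↦ (W₀.dvd_conductorNorm_iff_not_hasGoodReductionAtPrime q).mp hdvd hgood⟩
  have hirr : Irr W p :=
    hasIrreducibleModPGaloisRep_of_dvd_frobeniusTrace W p hp2
      (W.not_dvd_minimalDiscriminantInt_of_hasGoodReductionAtPrime' p hG.1) hG.2
  exact bsdp_of_cor102_twist_scopedAtThreeSDef_OPEN W₀ W p hBSTW hGZK hp3 hsst hss.1 hap hd hd1 hram' hC haux hirr (by omega)

/-- **Kobayashi's signed main conjecture AT THE (def)-SCOPED TWIST, CONDITIONAL on the `p ≥ 5` MC-level (def)-scoped tier** (BSTW Thm.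
10.1's twist clause restricted to the litref (def)-scope, `BurungaleSkinnerTianWan2024_thm101_twist_scopedSDef_OPEN`; UNREFEREED
preprint, never a theorem): from a scoped twist datum, for every sign. Closes nothing. [claim: BurungaleSkinnerTianWan2024, status: under-review]
[cite: BurungaleSkinnerTianWan2024, Thm. 10.1, last sentence (p. 86) with §10.3 (ANNOUNCED, OPEN binder, scoped)]
[cite: Kobayashi2003, Conjecture (Main Conjecture) (p. 2) (shape of the conclusion only)] -/
theorem kobayashiMainConjecture_of_thm101_twist_scopedSDef_OPEN_of_twistAuxDef
    (hBSTW : BurungaleSkinnerTianWan2024_thm101_twist_scopedSDef_OPEN) (hp5 : 5 ≤ p)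
    (htw : ∃ (W₀ : WeierstrassCurve ℚ) (_ : W₀.IsElliptic) (_ : W₀.IsGloballyMinimal) (d : ℤ) (C : VariableChange ℚ),
      Semistable W₀ ∧ GoodSS W₀ p ∧ W₀.frobeniusTrace p = 0 ∧ Squarefree d ∧ d ≠ 1 ∧
      (∀ (q : ℕ) [Fact q.Prime], RamifiedInQuadratic d q → q ≠ p ∧ W₀.HasGoodReductionAtPrime q) ∧
      C • W = W₀.quadraticTwist (d : ℚ) ∧ BSTWScope.IsAuxiliaryTwistDef W₀ p d) (ε : ℤˣ) :
    KobayashiMainConjecture W p ε := by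
  obtain ⟨W₀, _, _, d, C, hsst, hss, hap, hd, hd1, hram, hC, haux⟩ := htw
  have hram' : ∀ (q : ℕ) [Fact q.Prime], RamifiedInQuadratic d q → q ≠ p ∧ ¬ q ∣ W₀.conductorNorm ℤ := by
    intro q _ h
    obtain ⟨hqp, hgood⟩ := hram q h
    exact ⟨hqp, fun hdvd ↦ (W₀.dvd_conductorNorm_iff_not_hasGoodReductionAtPrime q).mp hdvd hgood⟩
  exact hBSTW W₀ W p d C hp5 hsst hss.1 hap hd hd1 hram' hC haux ε

/-- **The CRUX'S CONCLUSION `∃ ε, KobayashiLowerDivisibility W p ε` AT THE (def)-SCOPED TWIST** (item stmt-BirchSwinnertonDyer-19001's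
statement per pair), CONDITIONAL on the `p ≥ 5` MC-level (def)-scoped tier (witness `ε = 1`; OPEN main conjecture ⇒ its lower half,
`kobayashiLowerDivisibility_of_mainConjecture`). The crux itself is untouched. [claim: BurungaleSkinnerTianWan2024, status: under-review]
[cite: Kobayashi2003, Thm. 1.2, Thm. 4.1 and Conjecture (p. 2) (shape only)] -/
theorem exists_kobayashiLowerDivisibility_of_thm101_twist_scopedSDef_OPEN_of_twistAuxDef
    (hBSTW : BurungaleSkinnerTianWan2024_thm101_twist_scopedSDef_OPEN) (hp5 : 5 ≤ p)
    (htw : ∃ (W₀ : WeierstrassCurve ℚ) (_ : W₀.IsElliptic) (_ : W₀.IsGloballyMinimal) (d : ℤ) (C : VariableChange ℚ),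
      Semistable W₀ ∧ GoodSS W₀ p ∧ W₀.frobeniusTrace p = 0 ∧ Squarefree d ∧ d ≠ 1 ∧
      (∀ (q : ℕ) [Fact q.Prime], RamifiedInQuadratic d q → q ≠ p ∧ W₀.HasGoodReductionAtPrime q) ∧
      C • W = W₀.quadraticTwist (d : ℚ) ∧ BSTWScope.IsAuxiliaryTwistDef W₀ p d) :
    ∃ ε : ℤˣ, KobayashiLowerDivisibility W p ε :=
  ⟨1, kobayashiLowerDivisibility_of_mainConjecture
    (kobayashiMainConjecture_of_thm101_twist_scopedSDef_OPEN_of_twistAuxDef W p hBSTW hp5 htw 1)⟩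

/-- The same at `p = 3`, CONDITIONAL on the `p = 3` MC-level (def)-scoped tier (resting on the wall of record at 3).
[claim: BurungaleSkinnerTianWan2024, status: under-review] [cite: Kobayashi2003, Thm. 1.2, Thm. 4.1 and Conjecture (p. 2) (shape only)] -/
theorem exists_kobayashiLowerDivisibility_of_thm101_twist_scopedAtThreeSDef_OPEN_of_twistAuxDef
    (hBSTW : BurungaleSkinnerTianWan2024_thm101_twist_scopedAtThreeSDef_OPEN) (hp3 : p = 3)
    (htw : ∃ (W₀ : WeierstrassCurve ℚ) (_ : W₀.IsElliptic) (_ : W₀.IsGloballyMinimal) (d : ℤ) (C : VariableChange ℚ),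
      Semistable W₀ ∧ GoodSS W₀ p ∧ W₀.frobeniusTrace p = 0 ∧ Squarefree d ∧ d ≠ 1 ∧
      (∀ (q : ℕ) [Fact q.Prime], RamifiedInQuadratic d q → q ≠ p ∧ W₀.HasGoodReductionAtPrime q) ∧
      C • W = W₀.quadraticTwist (d : ℚ) ∧ BSTWScope.IsAuxiliaryTwistDef W₀ p d) :
    ∃ ε : ℤˣ, KobayashiLowerDivisibility W p ε := by
  obtain ⟨W₀, _, _, d, C, hsst, hss, hap, hd, hd1, hram, hC, haux⟩ := htw
  have hram' : ∀ (q : ℕ) [Fact q.Prime], RamifiedInQuadratic d q → q ≠ p ∧ ¬ q ∣ W₀.conductorNorm ℤ := by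
    intro q _ h
    obtain ⟨hqp, hgood⟩ := hram q h
    exact ⟨hqp, fun hdvd ↦ (W₀.dvd_conductorNorm_iff_not_hasGoodReductionAtPrime q).mp hdvd hgood⟩
  exact ⟨1, kobayashiLowerDivisibility_of_mainConjecture (hBSTW W₀ W p d C hp3 hsst hss.1 hap hd hd1 hram' hC haux 1)⟩

end ScopedDefConsumers

end Summit.BirchSwinnertonDyer.BirchSwinnertonDyer.Theorems.X7Twist

end
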